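import Summits.ResolutionOfSingularities.ResolutionOfSingularities.Theorems.WeightedInvariantWeightedConstructionLexmaxHullDefs

/-!
# Hull escape: the centre of a pointwise-lexmax-hull rule inhabits no datum on a two-point escape family

[OURS · L1 W4.3 · chain w43, stub worker 4] Helper for crux `WeightedConstruction`
(stmt-ResolutionOfSingularities-0571), line of record `pointwise-lexmax-hull`
(`Theorems/WeightedInvariantWeightedConstructionLexmaxHullDefs.lean`: `LexmaxHullRule`, `AdmissibleProfileAt`,
`chartProfile`, `XSing`). NOT a statement of any manuscript.

What is proved (sorry-free, for EVERY rule `R : LexmaxHullRule p`):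

* rule bookkeeping at closed singular points: `plex` is admissible and dominates every admissible profile,
  `gen = plex` at a closed point, `gen ≤ hull`, and `hull = gen` at a point that is its own only singular
  generisation (`LexmaxHullRule.plex_admissible`, `le_plex`, `gen_eq_plex_of_isClosed`, `gen_le_hull`,
  `hull_eq_gen_of_isolated`);
* the TWO-POINT PAIR: if the singular points of `(Y, X)` are exactly two closed points `a`, `b`, and some
  admissible profile at `a` strictly dominates every admissible profile at `b`, then `hull b < hull a` and
  the rule's centre is supported exactly on `{a}` (`hull_lt_of_twoPoint`,
  `centre_support_eq_singleton_of_twoPoint`);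
* consequently ANY algebraically-closed chart pre-datum `D` (`ACChartPreDatum p`, the target of the line's
  transfer stub `stub_recoding`) whose centre has the same support as the rule's centre on such a pair has
  `inv b < inv a` (`ACChartPreDatum.inv_lt_of_twoPoint`), and
* the ESCAPE THEOREM `LexmaxHullRule.hullEscape_false`: there is no sequence of two-point pairs
  `(Yₙ, Xₙ; aₙ, bₙ)` over one perfect field together with smooth correspondences identifying the germ at
  `bₙ` with the germ at `aₙ₊₁` (axiom `(i)`), on which `D`'s centre support agrees with the rule's — the
  values `inv aₙ` would strictly descend in the well-ordered `Γ_D` (lead a2's lever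
  `WeightedResolutionDatum_no_centreEscapeChain`, Cruxes/WeightedConstruction/CentreEscapeChain.lean, with
  the transfer now supplied by `(i)` and the supports read off the rule). Same for a full datum
  (`hullEscape_false_datum`, via `ACChartPreDatum.ofPreDatum ∘ PreDatum.ofDatum`, which keep the centre).

Why it matters (hand-verified witness, kernel version = the chart facts, filed separately): the fat points
`Fₙ := (𝔸ⁿ_k, 𝔪₀²)` have `plex(0) = (2,…,2 [n times], ⊤, …)` and these values STRICTLY DESCEND in the
`⊤`-padded lexicographic order of `Profile` (`(2,⊤) > (2,2,⊤) > …`); the pairs `Tₙ := Fₙ ⊔ Fₙ₊₁`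
(`= Spec (k[x₁..xₙ] × k[y₁..yₙ₊₁])`, smooth separated quasi-compact over `k`) with `aₙ = 0ₙ`, `bₙ = 0ₙ₊₁`
and the open immersions `Fₙ₊₁ ↪ Tₙ`, `Fₙ₊₁ ↪ Tₙ₊₁` as the correspondence satisfy every hypothesis of
`hullEscape_false`. Hence NO datum has centre support equal to the rule's hull-maximum locus on all pairs:
the transfer stub `stub_recoding` of the line admits no proof through `centre := R.centre` under the
current typing of `WeightedResolutionDatum` (one well-ordered `Γ` for all dimensions + `(i)` + `(iii)`) —
interface point (γ) of Cruxes/WeightedConstruction/STRATEGY-CENSUS.md §6 made concrete on the hull rule.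
-/

noncomputable section

open CategoryTheory AlgebraicGeometry Topology
open Literature.AlgebraicGeometry.Resolution

set_option linter.dupNamespace false -- mandated namespace of this single-conjunct summit

namespace Summit.ResolutionOfSingularities.ResolutionOfSingularities.Theorems.PointwiseLexmaxHull

namespace LexmaxHullRule

variable {p : ℕ} (R : LexmaxHullRule p)

section OnePair

variable {k : Type} [Field k] [CharP k p] [PerfectField k]
  {Y : Scheme.{0}} (f : Y ⟶ Spec (.of k)) [Smooth f] [IsSeparated f] [QuasiCompact f]
  (X : Y.IdealSheafData)

/-- At a closed singular point, `plex` is itself an admissible profile (R2). [OURS · folklore] -/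
theorem plex_admissible {y : Y} (hyc : IsClosed ({y} : Set Y)) (hys : XSing X y) :
    AdmissibleProfileAt X y (R.plex f X y) :=
  (R.plex_isGreatest f X y hyc hys).1

/-- At a closed singular point, `plex` dominates every admissible profile (R2). [OURS · folklore] -/
theorem le_plex {y : Y} (hyc : IsClosed ({y} : Set Y)) (hys : XSing X y) {π : Profile}
    (hπ : AdmissibleProfileAt X y π) : π ≤ R.plex f X y :=
  (R.plex_isGreatest f X y hyc hys).2 hπ

/-- At a CLOSED singular point the generic value is the pointwise value: `gen y = plex y` (Rg with the
closed specialisation `y ⤳ y`). [OURS · folklore] -/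
theorem gen_eq_plex_of_isClosed {y : Y} (hyc : IsClosed ({y} : Set Y)) (hys : XSing X y) :
    R.gen f X y = R.plex f X y := by
  obtain ⟨W, hyW, hW⟩ := R.gen_spec f X y hys
  exact (hW y hyW specializes_rfl hyc).symm

/-- At a singular point, `gen y ≤ hull y` (R1 with the trivial generisation `y ⤳ y`). [OURS · folklore] -/
theorem gen_le_hull {y : Y} (hys : XSing X y) : R.gen f X y ≤ R.hull f X y :=
  (R.hull_isGreatest f X y hys).2 ⟨y, specializes_rfl, hys, rfl⟩

/-- If `y` is its own only singular generisation, `hull y = gen y` (R1). [OURS · folklore] -/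
theorem hull_eq_gen_of_isolated {y : Y} (hys : XSing X y)
    (hiso : ∀ η : Y, η ⤳ y → XSing X η → η = y) : R.hull f X y = R.gen f X y := by
  obtain ⟨⟨η, hη, hηs, heq⟩, -⟩ := R.hull_isGreatest f X y hys
  rw [heq, hiso η hη hηs]

/-- **Two-point pair, values.** If the singular points of `(Y, X)` are exactly the closed points `a` and
`b`, and an admissible profile `π` at `a` strictly dominates every admissible profile at `b`, then
`hull b < hull a`. [OURS · folklore] -/
theorem hull_lt_of_twoPoint {a b : Y} (hac : IsClosed ({a} : Set Y)) (hbc : IsClosed ({b} : Set Y))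
    (has : XSing X a) (hbs : XSing X b) (hsing : ∀ y : Y, XSing X y → y = a ∨ y = b)
    {π : Profile} (hπa : AdmissibleProfileAt X a π)
    (hπb : ∀ π' : Profile, AdmissibleProfileAt X b π' → π' < π) :
    R.hull f X b < R.hull f X a := by
  -- `a ≠ b`: at `b` every admissible profile is `< π ≤ plex`, at `a` the profile `π` is admissible
  have hab : a ≠ b := by
    rintro rfl
    exact lt_irrefl _ ((hπb _ (R.plex_admissible f X hac has)).trans_le (R.le_plex f X hac has hπa))
  -- `b` is its own only singular generisation (a closed `a ≠ b` does not specialise to `b`)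
  have hiso : ∀ η : Y, η ⤳ b → XSing X η → η = b := by
    intro η hη hηs
    rcases hsing η hηs with rfl | rfl
    · have hb : b ∈ closure ({η} : Set Y) := specializes_iff_mem_closure.mp hη
      rw [hac.closure_eq, Set.mem_singleton_iff] at hb
      exact absurd hb.symm hab
    · rfl
  calc R.hull f X b = R.plex f X b := by
        rw [R.hull_eq_gen_of_isolated f X hbs hiso, R.gen_eq_plex_of_isClosed f X hbc hbs]
    _ < π := hπb _ (R.plex_admissible f X hbc hbs)
    _ ≤ R.plex f X a := R.le_plex f X hac has hπa
    _ = R.gen f X a := (R.gen_eq_plex_of_isClosed f X hac has).symm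
    _ ≤ R.hull f X a := R.gen_le_hull f X has

/-- **Two-point pair, centre.** Under the hypotheses of `hull_lt_of_twoPoint` the rule's centre is
supported exactly on `{a}` (Rc1: support = maximum locus of `hull` among singular points).
[OURS · folklore] -/
theorem centre_support_eq_singleton_of_twoPoint {a b : Y} (hac : IsClosed ({a} : Set Y))
    (hbc : IsClosed ({b} : Set Y)) (has : XSing X a) (hbs : XSing X b)
    (hsing : ∀ y : Y, XSing X y → y = a ∨ y = b)
    {π : Profile} (hπa : AdmissibleProfileAt X a π)
    (hπb : ∀ π' : Profile, AdmissibleProfileAt X b π' → π' < π) :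
    (R.centre f X).support = {a} := by
  have hlt := R.hull_lt_of_twoPoint f X hac hbc has hbs hsing hπa hπb
  rw [R.support_centre f X ⟨a, has⟩]
  ext y
  simp only [Set.mem_setOf_eq, Set.mem_singleton_iff]
  constructor
  · rintro ⟨hys, hmax⟩
    rcases hsing y hys with rfl | rfl
    · rfl
    · exact absurd (hmax a has) (not_le.mpr hlt)
  · rintro rfl
    refine ⟨has, fun y' hy's => ?_⟩
    rcases hsing y' hy's with rfl | rfl
    · exact le_rfl
    · exact hlt.le

end OnePair

end LexmaxHullRule

end Summit.ResolutionOfSingularities.ResolutionOfSingularities.Theorems.PointwiseLexmaxHull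

namespace Summit.ResolutionOfSingularities.ResolutionOfSingularities.Theorems

open PointwiseLexmaxHull

namespace ACChartPreDatum

variable {p : ℕ} (D : ACChartPreDatum p)

section OnePair

variable {k : Type} [Field k] [CharP k p] [PerfectField k]
  {Y : Scheme.{0}} (f : Y ⟶ Spec (.of k)) [Smooth f] [IsSeparated f] [QuasiCompact f]
  (X : Y.IdealSheafData)

/-- A singular point supplies the guard of `(iii)`/`(iv)`: `inv` is not minimal there (axiom `(ii)`).
[OURS · folklore] -/
theorem not_isBot_inv_of_xSing {y : Y} (hys : XSing X y) : ¬ IsBot (D.inv f X y) := by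
  obtain ⟨x, hx, hxreg⟩ := hys
  rw [D.isBot_inv_iff f X y]
  exact fun h => hxreg (h x hx)

/-- **Outside the centre, `inv` is strictly smaller than inside it** (for chart pre-data; lead a2's
`inv_lt_of_not_mem_support_centre_of_mem` is the same statement for full data). [OURS · folklore] -/
theorem inv_lt_of_not_mem_support_centre {a b : Y} (hguard : ∃ y : Y, ¬ IsBot (D.inv f X y))
    (ha : a ∈ (D.centre f X).support) (hb : b ∉ (D.centre f X).support) :
    D.inv f X b < D.inv f X a := by
  rw [D.support_centre f X hguard] at ha hb
  simp only [Set.mem_setOf_eq, not_forall, not_le] at ha hb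
  obtain ⟨y', hy'⟩ := hb
  exact lt_of_lt_of_le hy' (ha y')

/-- **Two-point pair, datum.** If the centre of `D` has the same support as the centre of a rule `R` on a
two-point pair as in `LexmaxHullRule.hull_lt_of_twoPoint`, then `inv b < inv a`. [OURS · folklore] -/
theorem inv_lt_of_twoPoint (R : LexmaxHullRule p) {a b : Y} (hac : IsClosed ({a} : Set Y))
    (hbc : IsClosed ({b} : Set Y)) (has : XSing X a) (hbs : XSing X b)
    (hsing : ∀ y : Y, XSing X y → y = a ∨ y = b)
    {π : Profile} (hπa : AdmissibleProfileAt X a π)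
    (hπb : ∀ π' : Profile, AdmissibleProfileAt X b π' → π' < π)
    (hagree : (D.centre f X).support = (R.centre f X).support) :
    D.inv f X b < D.inv f X a := by
  have hsupp : (D.centre f X).support = {a} := by
    rw [hagree, R.centre_support_eq_singleton_of_twoPoint f X hac hbc has hbs hsing hπa hπb]
  have hab : a ≠ b := by
    rintro rfl
    have hlt := R.hull_lt_of_twoPoint f X hac hbc has hbs hsing hπa hπb
    exact lt_irrefl _ hlt
  refine D.inv_lt_of_not_mem_support_centre f X ⟨a, D.not_isBot_inv_of_xSing f X has⟩ ?_ ?_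
  · rw [hsupp]; exact Set.mem_singleton a
  · rw [hsupp, Set.mem_singleton_iff]; exact fun h => hab h.symm

end OnePair

end ACChartPreDatum

end Summit.ResolutionOfSingularities.ResolutionOfSingularities.Theorems

namespace Summit.ResolutionOfSingularities.ResolutionOfSingularities.Theorems.PointwiseLexmaxHull

namespace LexmaxHullRule

variable {p : ℕ} (R : LexmaxHullRule p)

/-- **Hull escape theorem.** Let `R` be a rule and `D` an algebraically-closed chart pre-datum in
characteristic `p`. There is NO sequence of pairs `(Yₙ → Spec k, Xₙ)` in the regime (one perfect field `k`
of characteristic `p`; `Yₙ` smooth separated quasi-compact) whose singular points are exactly two closed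
points `aₙ`, `bₙ`, with an admissible profile `πₙ` at `aₙ` strictly dominating every admissible profile at
`bₙ`, with smooth correspondences `Yₙ ← Zₙ → Yₙ₊₁` over `k` pulling `Xₙ` and `Xₙ₊₁` back to the same ideal
sheaf and carrying a point `zₙ ↦ (bₙ, aₙ₊₁)`, and on which the support of `D`'s centre equals the support
of `R`'s centre: along such a sequence `inv_D aₙ₊₁ = inv_D bₙ < inv_D aₙ` (axiom `(i)` twice, then
`ACChartPreDatum.inv_lt_of_twoPoint`), an infinite strict descent in the well-ordered `Γ_D`.
(Hand-verified instance: `Yₙ = 𝔸ⁿ ⊔ 𝔸ⁿ⁺¹`, `Xₙ = 𝔪₀² ⊔ 𝔪₀²`, `aₙ = 0ₙ`, `bₙ = 0ₙ₊₁`, `πₙ = (2,…,2,⊤,…)`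
with `n` twos, `Zₙ = 𝔸ⁿ⁺¹` with the two coproduct inclusions — see the module docstring.)
[OURS · folklore] -/
theorem hullEscape_false (D : ACChartPreDatum p)
    (k : Type) [Field k] [CharP k p] [PerfectField k]
    (Y : ℕ → Scheme.{0}) (f : ∀ n, Y n ⟶ Spec (.of k))
    [∀ n, Smooth (f n)] [∀ n, IsSeparated (f n)] [∀ n, QuasiCompact (f n)]
    (X : ∀ n, (Y n).IdealSheafData) (a b : ∀ n, Y n)
    (hac : ∀ n, IsClosed ({a n} : Set (Y n))) (hbc : ∀ n, IsClosed ({b n} : Set (Y n)))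
    (has : ∀ n, XSing (X n) (a n)) (hbs : ∀ n, XSing (X n) (b n))
    (hsing : ∀ n (y : Y n), XSing (X n) y → y = a n ∨ y = b n)
    (π : ℕ → Profile) (hπa : ∀ n, AdmissibleProfileAt (X n) (a n) (π n))
    (hπb : ∀ n (π' : Profile), AdmissibleProfileAt (X n) (b n) π' → π' < π n)
    (hagree : ∀ n, (D.centre (f n) (X n)).support = (R.centre (f n) (X n)).support)
    (Z : ℕ → Scheme.{0}) (h : ∀ n, Z n ⟶ Spec (.of k))
    [∀ n, Smooth (h n)] [∀ n, IsSeparated (h n)] [∀ n, QuasiCompact (h n)]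
    (g : ∀ n, Z n ⟶ Y n) (g' : ∀ n, Z n ⟶ Y (n + 1)) [∀ n, Smooth (g n)] [∀ n, Smooth (g' n)]
    (hg : ∀ n, g n ≫ f n = h n) (hg' : ∀ n, g' n ≫ f (n + 1) = h n)
    (z : ∀ n, Z n) (hzb : ∀ n, g n (z n) = b n) (hza : ∀ n, g' n (z n) = a (n + 1))
    (hX : ∀ n, (X n).comap (g n) = (X (n + 1)).comap (g' n)) :
    False := by
  -- transfer: `inv aₙ₊₁ = inv bₙ` through the correspondence `Zₙ`
  have htransfer : ∀ n, D.inv (f (n + 1)) (X (n + 1)) (a (n + 1)) = D.inv (f n) (X n) (b n) := by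
    intro n
    rw [← hza n, ← hzb n, ← D.inv_comap (f (n + 1)) (h n) (g' n) (hg' n) (X (n + 1)) (z n),
      ← D.inv_comap (f n) (h n) (g n) (hg n) (X n) (z n), hX n]
  -- strict descent of `inv aₙ`
  have hlt : ∀ n, D.inv (f (n + 1)) (X (n + 1)) (a (n + 1)) < D.inv (f n) (X n) (a n) := fun n =>
    (htransfer n).trans_lt (D.inv_lt_of_twoPoint (f n) (X n) R (hac n) (hbc n) (has n) (hbs n)
      (hsing n) (hπa n) (hπb n) (hagree n))
  obtain ⟨n, hn⟩ :=
    WellFounded.not_rel_apply_succ (r := (· < ·)) (fun n => D.inv (f n) (X n) (a n))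
  exact hn (hlt n)

/-- **Hull escape theorem for full data**: the same for a `WeightedResolutionDatum p` (through the landed
forgetful maps `PreDatum.ofDatum`, `ACChartPreDatum.ofPreDatum`, which keep `Γ`, `inv` and `centre`).
[OURS · folklore] -/
theorem hullEscape_false_datum (D : WeightedResolutionDatum p)
    (k : Type) [Field k] [CharP k p] [PerfectField k]
    (Y : ℕ → Scheme.{0}) (f : ∀ n, Y n ⟶ Spec (.of k))
    [∀ n, Smooth (f n)] [∀ n, IsSeparated (f n)] [∀ n, QuasiCompact (f n)]
    (X : ∀ n, (Y n).IdealSheafData) (a b : ∀ n, Y n)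
    (hac : ∀ n, IsClosed ({a n} : Set (Y n))) (hbc : ∀ n, IsClosed ({b n} : Set (Y n)))
    (has : ∀ n, XSing (X n) (a n)) (hbs : ∀ n, XSing (X n) (b n))
    (hsing : ∀ n (y : Y n), XSing (X n) y → y = a n ∨ y = b n)
    (π : ℕ → Profile) (hπa : ∀ n, AdmissibleProfileAt (X n) (a n) (π n))
    (hπb : ∀ n (π' : Profile), AdmissibleProfileAt (X n) (b n) π' → π' < π n)
    (hagree : ∀ n, (D.centre (f n) (X n)).support = (R.centre (f n) (X n)).support)
    (Z : ℕ → Scheme.{0}) (h : ∀ n, Z n ⟶ Spec (.of k))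
    [∀ n, Smooth (h n)] [∀ n, IsSeparated (h n)] [∀ n, QuasiCompact (h n)]
    (g : ∀ n, Z n ⟶ Y n) (g' : ∀ n, Z n ⟶ Y (n + 1)) [∀ n, Smooth (g n)] [∀ n, Smooth (g' n)]
    (hg : ∀ n, g n ≫ f n = h n) (hg' : ∀ n, g' n ≫ f (n + 1) = h n)
    (z : ∀ n, Z n) (hzb : ∀ n, g n (z n) = b n) (hza : ∀ n, g' n (z n) = a (n + 1))
    (hX : ∀ n, (X n).comap (g n) = (X (n + 1)).comap (g' n)) :
    False :=
  R.hullEscape_false (ACChartPreDatum.ofPreDatum (PreDatum.ofDatum D)) k Y f X a b hac hbc has hbs hsing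
    π hπa hπb hagree Z h g g' hg hg' z hzb hza hX

end LexmaxHullRule

end Summit.ResolutionOfSingularities.ResolutionOfSingularities.Theorems.PointwiseLexmaxHull

end
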